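import Literature.AlgebraicGeometry.Frobenioids.DivisorMonoidCategoryTheoreticityThm42
import Literature.AlgebraicGeometry.Frobenioids.EquivalencePreStepsFSMType
import HarnessLib

/-!
# Frobenioids I, Theorem 4.2 (ii), (iii) AS TYPED over bases of FSM-type: the pre-step hypotheses
# discharged by the cell's Theorem 3.4 (ii) (FSM-type route)

Mochizuki, *The geometry of Frobenioids I: the general theory*, Kyushu J. Math. **62** (2008)
293–400, §4, Theorem 4.2 (ii)(iii), kurims pp. 77–81 [cite: MochizukiFrdI2008, Thm. 4.2 (ii) p.77], with
Theorem 3.4 (ii) p. 62 ("`Ψ` preserves pre-steps").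

PROOF-ONLY corollaries of `DivisorMonoidCategoryTheoreticityThm42.lean`: the hypotheses "`Ψ`, `Ψ⁻¹`
preserve (pre-)steps" of `thm42ii_of_perfectType` / `thm42iii_of` are DISCHARGED by the cell's kernel
proof of Thm. 3.4 (ii) over bases of FSM-type (`FrdI.isPreStep_map_of_isOfFSMType`, seat abc-iut-L1-t13,
file `EquivalencePreStepsFSMType.lean` — the repaired route; the printed route through Prop. 1.14 (iii)
is the cell's open finding PR-1), leaving: for (ii) perfect type + FSM-type bases + "`Ψ`, `Ψ⁻¹` preserve
primary pre-steps" [Thm. 4.2 (i)]; for (iii) FSM-type bases + "`Ψ` preserves Frobenius type, degrees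
[Thm. 3.4 (iii)], Div-identity endomorphisms [Thm. 4.2 (i)]" + the (ii)-clauses for `e`. Isotropy is read
off `Thm42Setting`. No new definitions.

Author: seat abc-iut-L1-t14 (staged `HOME/staging/L1/L1-t14/`, sha256 `27d54ce2c0b5`); filed unchanged but for
this paragraph by seat abc-iut-w4-d090 as filer-of-record (L1-lead ruling R81 (4), Thm. 4.2 closeout).
-/

namespace Literature.AlgebraicGeometry.Frobenioids

open CategoryTheory Opposite

namespace PreFrobenioidData

universe w v v' u u'

-- The cell's Thm. 3.4 (ii) (`FrdI.isPreStep_map_of_isOfFSMType`) is stated for two Frobenioids in the SAME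
-- universes; the corollaries below are accordingly same-universe specialisations of the
-- universe-polymorphic theorems of `DivisorMonoidCategoryTheoreticityThm42.lean`.
variable {D : Type u} [Category.{v} D] {Φ : Dᵒᵖ ⥤ CommMonCat.{w}} {C : Type u'} [Category.{v'} C]
  {F : C ⥤ ElemFrobenioid Φ}
variable {D₂ : Type u} [Category.{v} D₂] {Φ₂ : D₂ᵒᵖ ⥤ CommMonCat.{w}} {C₂ : Type u'}
  [Category.{v'} C₂] {F₂ : C₂ ⥤ ElemFrobenioid Φ₂} (Ψ : C ≌ C₂)

/-- Over bases of FSM-type and Frobenioids of isotropic type, `Ψ` preserves steps (Thm. 3.4 (ii),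
FSM-type route, + reflection of isomorphisms). [cite: MochizukiFrdI2008, Thm. 3.4 (ii) p.62] -/
theorem isStep_map_of_isOfFSMType (hF : PreFrobenioid.IsFrobenioid F) (hF₂ : PreFrobenioid.IsFrobenioid F₂)
    (hi : PreFrobenioid.IsOfIsotropicType F) (hi₂ : PreFrobenioid.IsOfIsotropicType F₂)
    (hD₂ : IsOfFSMType D₂) {X Y : C} {φ : X ⟶ Y} (hφ : PreFrobenioid.IsStep F φ) :
    PreFrobenioid.IsStep F₂ (Ψ.functor.map φ) :=
  ⟨FrdI.isPreStep_map_of_isOfFSMType hF hF₂ hi hi₂ hD₂ Ψ hφ.1, fun h => hφ.2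
    (by haveI := h; exact Ψ.fullyFaithfulFunctor.isIso_of_isIso_map φ)⟩

/-- **Theorem 4.2 (ii) as typed, perfect-type case over FSM-type bases, conditional only on Thm. 4.2 (i)**
("`Ψ`, `Ψ⁻¹` preserve primary pre-steps"). [cite: MochizukiFrdI2008, Thm. 4.2 (ii) p.77] -/
theorem thm42ii_of_perfectType_of_isOfFSMType (hF : PreFrobenioid.IsFrobenioid F)
    (hF₂ : PreFrobenioid.IsFrobenioid F₂)
    (hperf : PreFrobenioid.IsOfPerfectType F) (hperf₂ : PreFrobenioid.IsOfPerfectType F₂)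
    (hpf : Objectwise (fun M _ => IsPerfFactorial M) Φ)
    (hpf₂ : Objectwise (fun M _ => IsPerfFactorial M) Φ₂)
    (hD : IsOfFSMType D) (hD₂ : IsOfFSMType D₂)
    (hprim : ∀ ⦃X Y : C⦄ (φ : X ⟶ Y), PreFrobenioid.IsPrimaryPreStep F φ →
      PreFrobenioid.IsPrimaryPreStep F₂ (Ψ.functor.map φ))
    (hprim' : ∀ ⦃X Y : C₂⦄ (φ : X ⟶ Y), PreFrobenioid.IsPrimaryPreStep F₂ φ →
      PreFrobenioid.IsPrimaryPreStep F (Ψ.inverse.map φ)) :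
    (ofFunctor Φ F).Thm42ii (ofFunctor Φ₂ F₂) Ψ := by
  intro hS
  have histr := (ofFunctor_isOfIsotropicType F).mp hS.isotropic.1
  have histr₂ := (ofFunctor_isOfIsotropicType F₂).mp hS.isotropic.2
  exact thm42ii_of_perfectType Ψ hF hF₂ hperf hperf₂ hpf hpf₂
    (fun X Y φ hφ => isStep_map_of_isOfFSMType Ψ hF hF₂ histr histr₂ hD₂ hφ)
    (fun X Y φ hφ => isStep_map_of_isOfFSMType Ψ.symm hF₂ hF histr₂ histr hD hφ)
    (fun X Y φ hφ => FrdI.isPreStep_map_of_isOfFSMType hF hF₂ histr histr₂ hD₂ Ψ hφ)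
    (fun X Y φ hφ => FrdI.isPreStep_map_of_isOfFSMType hF₂ hF histr₂ histr hD Ψ.symm hφ)
    hprim hprim' hS

/-- **Theorem 4.2 (iii) as typed over FSM-type bases**, conditional on Thm. 3.4 (iii) ("`Ψ` preserves
Frobenius type and degrees"), Thm. 4.2 (i) ("`Ψ` preserves Div-identity endomorphisms") and the
conclusion of Thm. 4.2 (ii) for the family `e`. [cite: MochizukiFrdI2008, Thm. 4.2 (iii) p.78] -/
theorem thm42iii_of_isOfFSMType (hF : PreFrobenioid.IsFrobenioid F) (hF₂ : PreFrobenioid.IsFrobenioid F₂)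
    (hpf : Objectwise (fun M _ => IsPerfFactorial M) Φ)
    (hpf₂ : Objectwise (fun M _ => IsPerfFactorial M) Φ₂)
    (hD : IsOfFSMType D) (hD₂ : IsOfFSMType D₂)
    (hfrob : ∀ ⦃X Y : C⦄ (φ : X ⟶ Y), PreFrobenioid.IsFrobeniusType F φ →
      PreFrobenioid.IsFrobeniusType F₂ (Ψ.functor.map φ))
    (hdeg : ∀ ⦃X Y : C⦄ (φ : X ⟶ Y), PreFrobenioid.degFr F₂ (Ψ.functor.map φ) = PreFrobenioid.degFr F φ)
    (hdivid : ∀ (A : C) (α : A ⟶ A), PreFrobenioid.IsDivIdentity F α →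
      PreFrobenioid.IsDivIdentity F₂ (Ψ.functor.map α))
    (e : ∀ A : C, Primes (Φ.obj (op (PreFrobenioid.baseObj F A))) ≃
      Primes (Φ₂.obj (op (PreFrobenioid.baseObj F₂ (Ψ.functor.obj A)))))
    (he : ∀ (A : C) (𝔭 : Primes (Φ.obj (op (PreFrobenioid.baseObj F A)))),
      (∀ ⦃B : C⦄ (φ : A ⟶ B), PreFrobenioid.IsCoAngularPreStep F φ →
          (PreFrobenioid.Div F φ ∈ 𝔭.submonoid ↔
            PreFrobenioid.Div F₂ (Ψ.functor.map φ) ∈ (e A 𝔭).submonoid)) ∧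
        ∀ ⦃B : C⦄ (ψ : B ⟶ A), PreFrobenioid.IsCoAngularPreStep F ψ →
          ((∃ y ∈ 𝔭.submonoid, Frobenioids.pull Φ (PreFrobenioid.Base F ψ) y = PreFrobenioid.Div F ψ) ↔
            ∃ y ∈ (e A 𝔭).submonoid, Frobenioids.pull Φ₂ (PreFrobenioid.Base F₂ (Ψ.functor.map ψ)) y =
              PreFrobenioid.Div F₂ (Ψ.functor.map ψ))) :
    (ofFunctor Φ F).Thm42iii (ofFunctor Φ₂ F₂) Ψ e := by
  intro hS
  have histr := (ofFunctor_isOfIsotropicType F).mp hS.isotropic.1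
  have histr₂ := (ofFunctor_isOfIsotropicType F₂).mp hS.isotropic.2
  exact thm42iii_of Ψ hF hF₂ hpf hpf₂
    (fun X Y φ hφ => FrdI.isPreStep_map_of_isOfFSMType hF hF₂ histr histr₂ hD₂ Ψ hφ)
    (fun X Y φ hφ => FrdI.isPreStep_map_of_isOfFSMType hF₂ hF histr₂ histr hD Ψ.symm hφ)
    hfrob hdeg hdivid e he hS

end PreFrobenioidData

end Literature.AlgebraicGeometry.Frobenioids
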